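import Summits.CriticalPhenomena.PercolationContinuityZ3.Theorems.Transplant.FKConnectivityAllQForestToggleE
import Summits.CriticalPhenomena.PercolationContinuityZ3.Theorems.Transplant.FKConnectivityAllQForestTreeLevelPairCell
import HarnessLib

/-!
# The SERIES REDUCTION at the end `v` of `e` (tools): local facts, the toggle step and the set bookkeeping

(Part 1 of 2; the bijections `seriesEnd_first_eq_new/_free` and the assembled `adjForestNoSq_fibre_of_seriesEnd` are in `…ForestSeriesEnd`.)

Support file (`--supports stmt-CriticalPhenomena-4575`), FK sub-lane `prim-bschramm-fk-1` (generation 30) of the post-continuity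
programme; builds on p205010 (kernel theorem, internal audit signed; external expert review pending).  No definitions, no named facts,
no sorries; standard axioms.

SETTING: a fibre `(M₁ ∪ {g}, u)` of the node (♣)⁰ = `AdjForestRayleighNoSqOn` at the hub `o` (`e = ov`, `f = oy ∈ M₁` free) in which the
end `v` of `e` carries exactly the two free pairs `e` and `g = vw` (`w ∉ {o, v, y}`).  Splitting by the class of `g`:
* `g` in the SECOND class (`v` a leaf of both classes): the bad and the good colourings are EQUINUMEROUS — on the rest fibre `(M₁, u)` the
  vertex `v` is a leaf hanging on `o`, both partners absorb `e`, and g30's e-toggle (`adjForestNoSq_bad_absorb_eq_good_absorb`) applies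
  (**`seriesEnd_second_eq`**);
* `g` in the FIRST class (path `w – v – o` there, `v` isolated in the partner): replacing the path by the single pair `ow` is a bijection
  onto the colourings of the REDUCED fibre with hub pairs `ow, f` — `(M₁ ∖ {e} ∪ {ow}, u)` if `ow` is not a pair of the fibre
  (**`seriesEnd_first_eq_new`**), the pinned fibre `(M₁ ∖ {e, ow}, u ∪ {ow})` if `ow ∈ M₁` (**`seriesEnd_first_eq_free`**), and nothing if
  `ow` is pinned (a triangle `o v w` in one class);
so (**`adjForestNoSq_fibre_of_seriesEnd`**) the node on the fibre follows from the node on ONE reduced fibre over the support minus `v`.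
This is CHLW's Case 2(ii) at all levels; it is the step of the induction 'H1′ (`TwoCellBoundOn`) ⇒ node' (memo
bschramm/FROM-fk-1-g30-LAMAN-IDENTITIES.md §4) at an end of weighted degree two.
[cite: CibulkaHladkyLaCroixWagner2008, Thm. 1 (p. 2), Case 2(ii) (p. 4)] [cite: SempleWelsh2008, Conj. 1.1 (p. 2)] [cite: Linusson2011, Prop. 2.6]
[cite: Grimmett2006, §1.5 (p. 13)]
-/

noncomputable section

namespace Summit.CriticalPhenomena.PercolationContinuityZ3.Theorems
namespace FK

open MeasureTheory Set Literature.Probability.LatticeModels Literature.Probability.Percolation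
open scoped Classical symmDiff

variable {V : Type*} [Fintype V]

section SeriesEnd

variable {M₁ u : BondConfig V} {o v y w : V}

omit [Fintype V] in
/-- If `v` meets only `e = ov` among the pairs of `ω`, then `v ~_ω x` iff `x = v` or `o ~ x` off `e`. [folklore] -/
theorem reachable_end_iff {ω : BondConfig V} (hve : ∀ p ∈ ω, v ∈ p → p = s(o, v)) (he : s(o, v) ∈ ω) (x : V) :
    (openGraph ω).Reachable v x ↔ x = v ∨ (openGraph (ω \ {s(o, v)})).Reachable o x := by
  have hiso : ∀ p ∈ ω \ {s(o, v)}, v ∉ p := fun p hp hvp => hp.2 (hve p hp.1 hvp)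
  have hω : ω = insert s(v, o) (ω \ {s(o, v)}) := by rw [Sym2.eq_swap, insert_sdiff_singleton, insert_eq_of_mem he]
  conv_lhs => rw [hω]
  exact reachable_insert_of_isolated_iff hiso o x

omit [Fintype V] in
/-- If `v` meets no pair of `ζ`, then `ζ ∪ {vx}` is a forest configuration iff `ζ` is (`v ≠ x`). [folklore] -/
theorem insert_end_mem_forestEv_iff {ζ : BondConfig V} (hiso : ∀ p ∈ ζ, v ∉ p) {x : V} (hvx : v ≠ x) :
    insert s(v, x) ζ ∈ forestEv V ↔ ζ ∈ forestEv V :=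
  isForestCfg_insert_of_isolated hiso hvx

/-- **`g` second: bad = good.**  On the rest fibre `(M₁, u)` (where `v` meets only `e ∈ M₁`), the configuration-side events `e, f ∈ ω`
resp. `e ∈ ω` paired with the partner-side event "`ζ ∪ {g}` is a forest" (resp. "and `f ∈ ζ`") have equal counts — both partners absorb
`e`, so g30's e-toggle applies. [cite: CibulkaHladkyLaCroixWagner2008, Case 2(ii) (p. 4)] [cite: Linusson2011, Prop. 2.6] -/
theorem seriesEnd_second_eq (hov : o ≠ v) (hvw : v ≠ w) (heM : s(o, v) ∈ M₁) (hef : s(o, v) ≠ s(o, y))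
    (hgM : s(v, w) ∉ M₁) (hgu : s(v, w) ∉ u) (hv : ∀ p ∈ M₁ ∪ u, v ∈ p → p = s(o, v)) :
    fibreCount M₁ u ({ω | s(v, w) ∉ ω} ∩ (forestEv V ∩ {ω | s(o, v) ∈ ω ∧ s(o, y) ∈ ω}))
        ({ω | s(v, w) ∉ ω} ∩ {ω | insert s(v, w) ω ∈ forestEv V}) =
      fibreCount M₁ u ({ω | s(v, w) ∉ ω} ∩ (forestEv V ∩ {ω | s(o, v) ∈ ω}))
        ({ω | s(v, w) ∉ ω} ∩ {ω | insert s(v, w) ω ∈ forestEv V ∩ {ω | s(o, y) ∈ ω}}) := by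
  -- on the fibre: `g` is in no class, and a partner of a configuration containing `e` has `v` isolated
  have hgω : ∀ ω : BondConfig V, ω \ M₁ = u → s(v, w) ∉ ω := fun ω hω h =>
    ((subset_union_of_fibre hω).1 h).elim hgM hgu
  have hgζ : ∀ ω : BondConfig V, ω \ M₁ = u → s(v, w) ∉ ω ∆ M₁ := fun ω hω h =>
    ((subset_union_of_fibre hω).2 h).elim hgM hgu
  have hisoζ : ∀ ω : BondConfig V, ω \ M₁ = u → s(o, v) ∈ ω → ∀ p ∈ ω ∆ M₁, v ∉ p := by
    intro ω hω heω p hp hvp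
    have := hv p ((subset_union_of_fibre hω).2 hp) hvp
    subst this
    exact ((mem_symmDiff.1 hp).elim (fun h => h.2 heM) (fun h => h.2 heω))
  have hgf : s(v, w) ≠ s(o, y) := fun h => by
    have : v ∈ s(o, y) := h ▸ Sym2.mem_mk_left _ _
    rcases Sym2.mem_iff.1 this with h' | h'
    · exact hov h'.symm
    · exact hef (by rw [h'])
  have key := adjForestNoSq_bad_absorb_eq_good_absorb (u := u) heM hef
  have lhs : fibreCount M₁ u ({ω | s(v, w) ∉ ω} ∩ (forestEv V ∩ {ω | s(o, v) ∈ ω ∧ s(o, y) ∈ ω}))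
        ({ω | s(v, w) ∉ ω} ∩ {ω | insert s(v, w) ω ∈ forestEv V}) =
      fibreCount M₁ u (forestEv V ∩ {ω | s(o, v) ∈ ω ∧ s(o, y) ∈ ω}) (forestEv V ∩ {ζ | insert s(o, v) ζ ∈ forestEv V}) := by
    refine fibreCount_congr_fibre M₁ u fun ω hω => ?_
    constructor
    · rintro ⟨⟨-, hA⟩, -, hB⟩
      have hF : ω ∆ M₁ ∈ forestEv V := (insert_end_mem_forestEv_iff (hisoζ ω hω hA.2.1) hvw).1 hB
      refine ⟨hA, hF, ?_⟩
      have h' := (insert_end_mem_forestEv_iff (hisoζ ω hω hA.2.1) hov.symm).2 hF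
      rwa [Sym2.eq_swap] at h'
    · rintro ⟨hA, hF, -⟩
      exact ⟨⟨hgω ω hω, hA⟩, hgζ ω hω, (insert_end_mem_forestEv_iff (hisoζ ω hω hA.2.1) hvw).2 hF⟩
  have rhs : fibreCount M₁ u ({ω | s(v, w) ∉ ω} ∩ (forestEv V ∩ {ω | s(o, v) ∈ ω}))
        ({ω | s(v, w) ∉ ω} ∩ {ω | insert s(v, w) ω ∈ forestEv V ∩ {ω | s(o, y) ∈ ω}}) =
      fibreCount M₁ u (forestEv V ∩ {ω | s(o, v) ∈ ω}) (forestEv V ∩ {ζ | s(o, y) ∈ ζ} ∩ {ζ | insert s(o, v) ζ ∈ forestEv V}) := by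
    refine fibreCount_congr_fibre M₁ u fun ω hω => ?_
    constructor
    · rintro ⟨⟨-, hA⟩, -, hB, hfB⟩
      have hF : ω ∆ M₁ ∈ forestEv V := (insert_end_mem_forestEv_iff (hisoζ ω hω hA.2) hvw).1 hB
      have hf' : s(o, y) ∈ ω ∆ M₁ := by
        rcases mem_insert_iff.1 hfB with h | h
        · exact absurd h.symm hgf
        · exact h
      refine ⟨hA, ⟨hF, hf'⟩, ?_⟩
      have h' := (insert_end_mem_forestEv_iff (hisoζ ω hω hA.2) hov.symm).2 hF
      rwa [Sym2.eq_swap] at h'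
    · rintro ⟨hA, ⟨hF, hf'⟩, -⟩
      exact ⟨⟨hgω ω hω, hA⟩, hgζ ω hω, (insert_end_mem_forestEv_iff (hisoζ ω hω hA.2) hvw).2 hF, mem_insert_of_mem _ hf'⟩
  rw [lhs, rhs, key]

omit [Fintype V] in
/-- Fibre bookkeeping for the series map `ω ↦ (ω ∖ {e}) ∪ {h}`. [folklore] -/
theorem seriesMap_sdiff (ω : BondConfig V) {e h : Sym2 V} (heω : e ∈ ω) (heM : e ∈ M₁) (hhω : h ∉ ω) (hhM : h ∉ M₁) :
    insert h (ω \ {e}) \ insert h (M₁ \ {e}) = ω \ M₁ := by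
  have heh : e ≠ h := fun x => hhM (x ▸ heM)
  ext p
  simp only [mem_sdiff, mem_insert_iff, mem_singleton_iff]
  by_cases hp : p = h
  · subst hp; tauto
  · by_cases hpe : p = e
    · subst hpe; tauto
    · tauto

omit [Fintype V] in
/-- Partner bookkeeping for the series map: the partner is unchanged. [folklore] -/
theorem seriesMap_symmDiff (ω : BondConfig V) {e h : Sym2 V} (heω : e ∈ ω) (heM : e ∈ M₁) (hhω : h ∉ ω) (hhM : h ∉ M₁) :
    insert h (ω \ {e}) ∆ insert h (M₁ \ {e}) = ω ∆ M₁ := by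
  have heh : e ≠ h := fun x => hhM (x ▸ heM)
  ext p
  simp only [mem_symmDiff, mem_insert_iff, mem_sdiff, mem_singleton_iff]
  by_cases hp : p = h
  · subst hp; tauto
  · by_cases hpe : p = e
    · subst hpe; tauto
    · tauto

omit [Fintype V] in
/-- Fibre bookkeeping when `h` is a free pair that becomes pinned. [folklore] -/
theorem seriesMap_sdiff_free (ω : BondConfig V) {e h : Sym2 V} (heω : e ∈ ω) (heM : e ∈ M₁) (hhω : h ∉ ω) (hhM : h ∈ M₁)
    (heh : e ≠ h) :
    insert h (ω \ {e}) \ (M₁ \ {e, h}) = insert h (ω \ M₁) := by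
  ext p
  simp only [mem_sdiff, mem_insert_iff, mem_singleton_iff]
  by_cases hp : p = h
  · subst hp; tauto
  · by_cases hpe : p = e
    · subst hpe; tauto
    · tauto

omit [Fintype V] in
/-- Partner bookkeeping for the free case: the partner is unchanged. [folklore] -/
theorem seriesMap_symmDiff_free (ω : BondConfig V) {e h : Sym2 V} (heω : e ∈ ω) (heM : e ∈ M₁) (hhω : h ∉ ω) (hhM : h ∈ M₁)
    (heh : e ≠ h) :
    insert h (ω \ {e}) ∆ (M₁ \ {e, h}) = ω ∆ M₁ := by
  ext p
  simp only [mem_symmDiff, mem_insert_iff, mem_sdiff, mem_singleton_iff]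
  by_cases hp : p = h
  · subst hp; tauto
  · by_cases hpe : p = e
    · subst hpe; tauto
    · tauto

omit [Fintype V] in
/-- The series map is undone by the reverse map. [folklore] -/
theorem seriesMap_cancel (ω : BondConfig V) {e h : Sym2 V} (heω : e ∈ ω) (hhω : h ∉ ω) (heh : e ≠ h) :
    insert e (insert h (ω \ {e}) \ {h}) = ω := by
  ext p
  simp only [mem_insert_iff, mem_sdiff, mem_singleton_iff]
  by_cases hp : p = h
  · subst hp; tauto
  · by_cases hpe : p = e
    · subst hpe; tauto
    · tauto

omit [Fintype V] in
/-- Pairs other than `e, h` lie in `(ω ∖ {e}) ∪ {h}` iff they lie in `ω`. [folklore] -/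
theorem mem_seriesMap_iff {ω : BondConfig V} {e h p : Sym2 V} (hpe : p ≠ e) (hph : p ≠ h) :
    p ∈ insert h (ω \ {e}) ↔ p ∈ ω := by
  simp only [mem_insert_iff, mem_sdiff, mem_singleton_iff]
  tauto

omit [Fintype V] in
/-- `v` meets only `e` among the pairs of a configuration of a fibre whose pairs at `v` are only `e`. [folklore] -/
theorem end_only_of_fibre {N u' ω : BondConfig V} (hv : ∀ p ∈ N ∪ u', v ∈ p → p = s(o, v)) (hω : ω \ N = u') :
    ∀ p ∈ ω, v ∈ p → p = s(o, v) := fun p hp hvp => hv p ((subset_union_of_fibre hω).1 hp) hvp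

omit [Fintype V] in
/-- Backward fibre bookkeeping for the free case. [folklore] -/
theorem seriesMap_sdiff_back_free (ω : BondConfig V) {e h : Sym2 V} (heω : e ∉ ω) (heM : e ∈ M₁) (hhM : h ∈ M₁) (heh : e ≠ h) :
    insert e (ω \ {h}) \ M₁ = (ω \ (M₁ \ {e, h})) \ {h} := by
  ext p
  simp only [mem_sdiff, mem_insert_iff, mem_singleton_iff]
  by_cases hp : p = h
  · subst hp; tauto
  · by_cases hpe : p = e
    · subst hpe; tauto
    · tauto

omit [Fintype V] in
/-- Backward partner bookkeeping for the free case. [folklore] -/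
theorem seriesMap_symmDiff_back_free (ω : BondConfig V) {e h : Sym2 V} (heω : e ∉ ω) (hhω : h ∈ ω) (heM : e ∈ M₁) (hhM : h ∈ M₁)
    (heh : e ≠ h) :
    insert e (ω \ {h}) ∆ M₁ = ω ∆ (M₁ \ {e, h}) := by
  ext p
  simp only [mem_symmDiff, mem_insert_iff, mem_sdiff, mem_singleton_iff]
  by_cases hp : p = h
  · subst hp; tauto
  · by_cases hpe : p = e
    · subst hpe; tauto
    · tauto

omit [Fintype V] in
/-- Reading `{ω | ω ∪ {g} ∈ Fo ∩ P}` for an event `P` built from pairs other than `g`. [folklore] -/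
theorem insert_mem_forest_inter_iff {ω : BondConfig V} {g : Sym2 V} {P : Set (BondConfig V)} (hP : insert g ω ∈ P ↔ ω ∈ P) :
    ω ∈ {ω : BondConfig V | insert g ω ∈ forestEv V ∩ P} ↔ ω ∈ {ω : BondConfig V | insert g ω ∈ forestEv V} ∩ P :=
  ⟨fun h => ⟨h.1, hP.1 h.2⟩, fun h => ⟨h.1, hP.2 h.2⟩⟩

end SeriesEnd

end FK
end Summit.CriticalPhenomena.PercolationContinuityZ3.Theorems

end
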